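/-
Copyright (c) 2026 the pub-hodgecm-mathlib formalisation cell (harness21).  Prover seat hodgecm-mathlib-A-p19 (g29): road «S3-ram» (LEAD F0P3a-plan (g13); owner ∕ (α) keeper
F0P3a-p06 (g16); (Cnt2′) chair F0P3a-p07 (g15) RULING (16)(b)∕(18)), heir of F0P3a-p05 (g18)'s A-even glue (g1)–(g3) (HANDOFF § F0P3a-p05 FINAL); 2026-09-02.
-/
import Literature.NumberTheory.Rogawski1990.DepthZeroKappaTransferTypeTwoRamifiedHyperbolicVertexFrame      -- ★ p849477 (A-p12 (g25)) (K4b) 1/3: frame bookkeeping (`endoGL_one_inv_mul_endoGL_one_mul_endoGL_one`, …); regime-B frame lemma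
import Literature.NumberTheory.Rogawski1990.DepthZeroKappaTransferTypeTwoRamifiedHyperbolicVertexTokens     -- ★ p849511 (A-p12 (g25)) (K4b) 2/3: `inner_token_iff_of_axisFrame`, `big_token_iff_of_axisFrame`, `apply_sub_centre_eq_of_trace`
import Literature.NumberTheory.Rogawski1990.DepthZeroKappaTransferTypeTwoRamifiedBlockVertexCensusTop       -- ★ p849446 (F0P3a-p05 (g18)): `blockVertexCensus_top`
import Literature.NumberTheory.Automorphic.UnitaryLatticeTreeBlockRootRegionAxisKindsTop                     -- ★ p849492 (F0P3a-p05 (g18)): `ncard_rootRegion_inner_eq_ncard_two_of_top`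
import Literature.NumberTheory.Automorphic.UnitaryLatticeTreeBlockRootRegionAxisTop                          -- ★ p849253 (F0P3a-p01 (g18)): `single_one_one_mem_of_mem_rootRegion_of_top`
import Literature.NumberTheory.Automorphic.UnitaryLatticeTreeNilpotencyTokenOfDepths                         -- ★ `map_sub_one_pow_three_le_scaleLattice_of_charpoly_block_antidiagonal` (`hnil3`)
import Literature.NumberTheory.Automorphic.UnitaryLatticeTreeFrameLiteralCentring                            -- ★ p849172 (this seat): `charpoly_coe_endoGL_one`, `endoGL_one_mem_unitaryInt`, `map_sub_one_stdLattice_le_scaleLattice_endoGL_one`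
import Literature.NumberTheory.Automorphic.UnitaryLatticeTreeFramesOfInvolution                              -- ★ `isTree_latticeGraph_three_of_neg`
import HarnessLib

/-!
# The ramified `κ`-orbital integral, TYPE (2): THE PER-VERTEX CENSUS AT THE TOP ROOT VERTICES OF THE HYPERBOLIC BLOCK LITERAL (regime A-even; organ (4b) glue (g1)–(g3))
# (Kottwitz 1986 §3; Rogawski 1990 §4.9; Labesse–Langlands 1979 §2; Bruhat–Tits 1972 §10)

Topic `NumberTheory/Rogawski1990`; namespace `Literature.NumberTheory.Rogawski1990.TypeOneRamifiedJunction`.  THEOREMS ONLY (no definition, no instance, no notation, no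
named fact, no `sorry`); kernel lane `--supports stmt-HodgeConjecture-24833`; datum-free (`K` with `Valued K ℤᵐ⁰`, `σ` a valuation-preserving involution with `σϖ = −ϖ`,
`|2| = 1`).  Cell `pub/hodgecm-mathlib` (D-0151), crux H413 `HCCMStratifiedTransfer`; road «S3-ram» (Literature seeding, count-neutral); (Cnt2′) route B, chair RULING (16)(b)
«regime A-even», the three glue items (g1)–(g3) left OPEN for the pen by F0P3a-p05 (g18) (HANDOFF § «F0P3a-p05 (g18) — FINAL», 05:34Z): the hyperbolic literal in the centred
`J₀`-model is `γ = ι(B₀, 1)` with `B₀ ∈ U(σ, !![0,1;1,0])` DEEP `|(B₀ − 1)ᵢⱼ| ≤ |ϖ|^{d₀}` (`d₀ = N − 1` odd), `|tr² − 4det|(B₀) < |ϖ|^{2d₀}`, TOP `|½tr B₀ − 1| ≤ |ϖ^(d₀+1)|` with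
EMPTY centred top `W`-ball (★ F0P3a-p05 part X), and `R = {v ∣ γ·v = v ∧ SD v.1 ∧ (γ − 1)·v.1 ≤ ϖ^{d₀}·v.1}` its root region (the `q + 1` axis vertices, ★ p849253 ∕ p849413):

* §1 **(g1) `exists_adaptedAxisFrame_of_single_one_one_mem`** — A-p12 (g25)'s ★ (K4b-F) `exists_adaptedAxisFrame_of_mem_rootRegion` with its regime-B step (a) («`e₁ ∈ v.1`» from
  `|½tr B₀ − 1| = |ϖ|^{d₀}`) replaced by the HYPOTHESIS `he : e₁ ∈ v.1` (steps (b)–(e) verbatim: ★ `exists_latt_endoGL_eq_of_single_mem`, rank-2 transitivity, ★ (K3) dichotomy,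
  the flip `k ↦ k·w₀`); at the top `he` is ★ p849253 `single_one_one_mem_of_mem_rootRegion_of_top`;
* §2 **(g2) `v_inv_pow_mul_one_sub_apply_lt_one_of_top`** — on a J-symmetric block frame with `tr g₁ = tr B₀` and `|½tr B₀ − 1| ≤ |ϖ^(d₀+1)|`: `|ϖ^{−d₀}(1 − g₁,₀₀)| < 1`, i.e. the
  scalar key `res CO = 0` of ★ `blockVertexCensus_top`; the second key `res LO ≠ 0` is «no top root vertex is INNER» (★ p849492 `ncard_rootRegion_inner_eq_ncard_two_of_top` + the
  empty top ball + ★ `inner_token_iff_of_axisFrame`);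
* §3 **(g3) + assembly `hyperbolicVertexCensus_top`** — for every `v ∈ R`: `#E(v) = 0`, and with the CENTRED kind `Q v :≡ ¬Pin v ∧ Qbig_(−c₁) v` (F0P3a-p08 (g21) ∕ A-p12 (g25) token
  texts, constant `t := nc₁ = −c₁`; its link to ★ `blockVertexCensus_top`'s indicator `χ((res nc₁)⁻¹·l̄) = 1` is ★ `big_token_iff_of_axisFrame` at `(CO, T₀) := (−nc₁, nc₁)`):
  `Q v → (#P, #M)(v) = (q², 0)`, `¬Q v → (#P, #M)(v) = (0, q²)` (`q = Fintype.card 𝓀[K]`; the `hP∕hM` sets of ★ (4a) `regionCensus_block_of_kindCounts` VERBATIM).  With ★ XIII-b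
  (`2·#{v ∈ R ∣ Q v} = q + 1`) these are exactly the hypotheses `hE0 ∕ hPM` and `hE0 ∕ hPQ ∕ hPnQ ∕ hMQ ∕ hMnQ ∕ hQ` of ★ p849529 `BlockLawHyp.zhyp_{zero,pm}_even_A_ram_of_topVertexCensus`.
HONEST LABEL: HC_CM is proved only modulo the 2 remaining named inputs (hLiu418 24832, h413 24833) until rung 0 closes; nothing printed is asserted here (lattice bookkeeping over
★ results); «S3-ram» has no books consequence.

## References
* [Kottwitz1986] R. E. Kottwitz, *Base change for unit elements of Hecke algebras*, Compositio Math. 60 (1986), §3 (counting fixed lattices shell by shell).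
* [Rogawski1990] J. D. Rogawski, *Automorphic Representations of Unitary Groups in Three Variables*, Ann. of Math. Stud. 123 (1990), §4.8 Case (a) p. 53, §4.9 pp. 54–56, Prop. 4.9.1 (b), Lemma 4.9.3.
* [LabesseLanglands1979] J.-P. Labesse, R. P. Langlands, *L-indistinguishability for SL(2)*, Canad. J. Math. 31 (1979), §2 Lemma 2.1 p. 8.
* [BruhatTits1972] F. Bruhat, J. Tits, *Groupes réductifs sur un corps local I*, Publ. Math. IHÉS 41 (1972), §10 (lattice models of the building).
* [Jacobowitz1962] R. Jacobowitz, *Hermitian forms over local fields*, Amer. J. Math. 84 (1962), §8.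
-/

set_option autoImplicit false

noncomputable section

open scoped Valued WithZero Matrix MatrixGroups
open Polynomial Classical SimpleGraph
open Literature.NumberTheory.Automorphic Literature.NumberTheory.Automorphic.HermitianLattice Literature.NumberTheory.Automorphic.UnitaryLatticeTree
open Literature.NumberTheory.Automorphic.UnitaryGroup

namespace Literature.NumberTheory.Rogawski1990.TypeOneRamifiedJunction

variable {K : Type*} [Field K] [Valued K ℤᵐ⁰] {σ : K →+* K} {ϖ : K}

/-! ## §1 (g1) The adapted axis block frame of an AXIS region vertex -/

set_option maxHeartbeats 1600000 in
/-- **(g1) THE ADAPTED AXIS BLOCK FRAME OF AN AXIS REGION VERTEX** — A-p12 (g25)'s ★ (K4b-F) `exists_adaptedAxisFrame_of_mem_rootRegion` with the axis property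
`e₁ ∈ v.1` as a HYPOTHESIS (`he`) instead of its regime-B derivation: for `↑γ = ι(B₀, 1)` (`|tr(B₀)² − 4det B₀| < |ϖ|^{2d₀}`, `d₀` odd, `|2| = 1`, `σϖ = −ϖ`) and a self-dual
vertex `v` with `(γ − 1)·v.1 ≤ ϖ^{d₀}·v.1` and `e₁ ∈ v.1`: `v = u·r₀` for an AXIS frame `u = ι(k, 1)`, `k ∈ U(σ, Φ₂)`, with `↑(u⁻¹γu) = ι(g₁, 1)`, `tr g₁ = tr B₀`, `det g₁ = det B₀`,
DEEP, ADAPTED and J-SYMMETRIC (steps (b)–(e) of A-p12's proof verbatim). [cite: BruhatTits1972, §10] [cite: Kottwitz1986, §3] [cite: Rogawski1990, §4.9 Lemma 4.9.3 p. 56]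
[cite: Jacobowitz1962, §8] -/
theorem exists_adaptedAxisFrame_of_single_one_one_mem [IsPrincipalIdealRing 𝒪[K]]
    (hσ : ∀ x, σ (σ x) = x) (hvσ : ∀ a, Valued.v (σ a) = Valued.v a) (hσϖ : σ ϖ = -ϖ)
    (hϖ : Valued.v ϖ = WithZero.exp (-1 : ℤ)) (hres : ∀ x : K, Valued.v x ≤ 1 → Valued.v (σ x - x) < 1) (h2 : Valued.v (2 : K) = 1)
    (γ : unitaryGroupOfForm σ ((StdForm.antidiagonal 3).over K)) (B₀ : GL (Fin 2) K) (hγ : (γ : GL (Fin 3) K) = endoGL (B₀, (1 : GL (Fin 1) K)))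
    {d₀ : ℕ} (hodd : Odd d₀)
    (hdisc : Valued.v ((B₀ : Matrix (Fin 2) (Fin 2) K).trace ^ 2 - 4 * (B₀ : Matrix (Fin 2) (Fin 2) K).det) < Valued.v ϖ ^ (2 * d₀))
    {v : {M : Submodule 𝒪[K] (Fin 3 → K) // IsVertex σ ϖ ((StdForm.antidiagonal 3).over K) M}}
    (hv : IsSelfDualLattice σ ϖ ((StdForm.antidiagonal 3).over K) v.1)
    (hvR : v.1.map ((Matrix.toLin' (((γ : GL (Fin 3) K) : Matrix (Fin 3) (Fin 3) K) - 1)).restrictScalars 𝒪[K]) ≤ scaleLattice (ϖ ^ d₀) v.1)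
    (he : (Pi.single 1 1 : Fin 3 → K) ∈ v.1) :
    ∃ k : GL (Fin 2) K, k ∈ unitaryGroupOfForm σ ((StdForm.antidiagonal 2).over K) ∧
      ∃ u : unitaryGroupOfForm σ ((StdForm.antidiagonal 3).over K), (u : GL (Fin 3) K) = endoGL (k, (1 : GL (Fin 1) K)) ∧
        v = latticeGraphIso σ ϖ ((StdForm.antidiagonal 3).over K) u ⟨stdLattice K 3, 0, isSelfDualLattice_stdLattice_three_of_v hϖ⟩ ∧
        ∃ g₁ : GL (Fin 2) K, ((u⁻¹ * γ * u : unitaryGroupOfForm σ ((StdForm.antidiagonal 3).over K)) : GL (Fin 3) K) = endoGL (g₁, (1 : GL (Fin 1) K)) ∧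
          (g₁ : Matrix (Fin 2) (Fin 2) K).trace = (B₀ : Matrix (Fin 2) (Fin 2) K).trace ∧ (g₁ : Matrix (Fin 2) (Fin 2) K).det = (B₀ : Matrix (Fin 2) (Fin 2) K).det ∧
          (∀ i j, Valued.v (((g₁ : Matrix (Fin 2) (Fin 2) K) - 1) i j) ≤ Valued.v ϖ ^ d₀) ∧
          Valued.v ((ϖ ^ d₀)⁻¹ * (g₁ : Matrix (Fin 2) (Fin 2) K) 1 0) < 1 ∧
          Valued.v ((ϖ ^ d₀)⁻¹ * ((((g₁ : Matrix (Fin 2) (Fin 2) K) - 1) 0 0) - (((g₁ : Matrix (Fin 2) (Fin 2) K) - 1) 1 1))) < 1 := by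
  have hϖ0 : ϖ ≠ 0 := fun h0 => by rw [h0, map_zero] at hϖ; exact WithZero.coe_ne_zero hϖ.symm
  have hvϖ0 : Valued.v ϖ ≠ 0 := (Valuation.ne_zero_iff _).2 hϖ0
  have hϖ1 : Valued.v ϖ ≤ 1 := by rw [hϖ, ← WithZero.exp_zero]; exact WithZero.exp_le_exp.2 (by norm_num)
  have hϖD0 : (ϖ ^ d₀ : K) ≠ 0 := pow_ne_zero _ hϖ0
  -- (b) an endoscopic block frame of the lattice
  obtain ⟨g₃, hMg, -, -, -⟩ := id hv
  have hSD' : IsSelfDualLattice σ ϖ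
      (!![(!![(0 : K), 1; 1, 0] : Matrix (Fin 2) (Fin 2) K) 0 0, 0, (!![(0 : K), 1; 1, 0] : Matrix (Fin 2) (Fin 2) K) 0 1; 0, (1 : K), 0;
        (!![(0 : K), 1; 1, 0] : Matrix (Fin 2) (Fin 2) K) 1 0, 0, (!![(0 : K), 1; 1, 0] : Matrix (Fin 2) (Fin 2) K) 1 1] : Matrix (Fin 3) (Fin 3) K) v.1 := by
    rw [← antidiagonal_three_over_eq_endoShape]; exact hv
  have hH₂ : IsUnit (!![(0 : K), 1; 1, 0] : Matrix (Fin 2) (Fin 2) K).det := by rw [Matrix.det_fin_two]; simp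
  have hHdet : IsUnit (!![(!![(0 : K), 1; 1, 0] : Matrix (Fin 2) (Fin 2) K) 0 0, 0, (!![(0 : K), 1; 1, 0] : Matrix (Fin 2) (Fin 2) K) 0 1; 0, (1 : K), 0;
        (!![(0 : K), 1; 1, 0] : Matrix (Fin 2) (Fin 2) K) 1 0, 0, (!![(0 : K), 1; 1, 0] : Matrix (Fin 2) (Fin 2) K) 1 1] : Matrix (Fin 3) (Fin 3) K).det := by
    rw [← antidiagonal_three_over_eq_endoShape]; exact isUnit_det_antidiagonal
  have hax : ∀ x ∈ v.1, Valued.v (x 1) ≤ 1 := by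
    intro x hx
    have hdual := dualLatt_eq_self_of_isSelfDualLattice hvσ hHdet hSD'
    have hx' : x ∈ dualLatt σ (!![(!![(0 : K), 1; 1, 0] : Matrix (Fin 2) (Fin 2) K) 0 0, 0, (!![(0 : K), 1; 1, 0] : Matrix (Fin 2) (Fin 2) K) 0 1; 0, (1 : K), 0;
        (!![(0 : K), 1; 1, 0] : Matrix (Fin 2) (Fin 2) K) 1 0, 0, (!![(0 : K), 1; 1, 0] : Matrix (Fin 2) (Fin 2) K) 1 1] : Matrix (Fin 3) (Fin 3) K) v.1 := by
      rw [hdual]; exact hx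
    have hp := hx' _ he
    rw [pairing_endoShape_apply] at hp
    have e0 : (![(Pi.single 1 1 : Fin 3 → K) 0, (Pi.single 1 1 : Fin 3 → K) 2] : Fin 2 → K) = 0 := by ext i; fin_cases i <;> simp
    rw [e0, map_zero, LinearMap.zero_apply, zero_add] at hp
    simpa using hp
  obtain ⟨g₂, hg₂⟩ := exists_latt_endoGL_eq_of_single_mem g₃ (by rw [← hMg]; exact he) (by rw [← hMg]; exact hax)
  -- (c) the W-block lattice is self-dual, hence `k·𝒪²` for a unitary `k`
  have hSD₂ : IsSelfDualLattice σ ϖ ((StdForm.antidiagonal 2).over K) (latt (g₂ : Matrix (Fin 2) (Fin 2) K)) := by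
    have hΦ₂ : (StdForm.antidiagonal 2).over K = !![(0 : K), 1; 1, 0] := by
      ext i j; fin_cases i <;> fin_cases j <;> simp [StdForm.over, StdForm.antidiagonal_J_apply]
    rw [hΦ₂, ← isSelfDualLattice_latt_endoGL_one_iff σ hvσ hϖ0 hϖ1 _ (h := (1 : K)) (by rw [map_one]) g₂, hg₂, ← hMg]
    exact hSD'
  obtain ⟨k, hk⟩ := exists_unitary_mapGL_stdLattice_eq_of_isSelfDualLattice_two_of_v_two hσ hvσ hϖ h2 hSD₂
  have hlatt₂ : latt (g₂ : Matrix (Fin 2) (Fin 2) K) = latt ((k : GL (Fin 2) K) : Matrix (Fin 2) (Fin 2) K) := hk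
  have hvk : v.1 = latt ((endoGL ((k : GL (Fin 2) K), (1 : GL (Fin 1) K)) : GL (Fin 3) K) : Matrix (Fin 3) (Fin 3) K) := by
    rw [hMg, ← hg₂]; exact (latt_endoGL_one_eq_iff _ _).2 hlatt₂
  -- (d) J-symmetry and the off-diagonal dichotomy of `k₁⁻¹ B₀ k₁` for ANY unitary `k₁` with `v = ι(k₁,1)·r₀`
  have key : ∀ k₁ : GL (Fin 2) K, k₁ ∈ unitaryGroupOfForm σ ((StdForm.antidiagonal 2).over K) →
      v.1 = latt ((endoGL (k₁, (1 : GL (Fin 1) K)) : GL (Fin 3) K) : Matrix (Fin 3) (Fin 3) K) →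
      ∃ u : unitaryGroupOfForm σ ((StdForm.antidiagonal 3).over K), (u : GL (Fin 3) K) = endoGL (k₁, (1 : GL (Fin 1) K)) ∧
        v = latticeGraphIso σ ϖ ((StdForm.antidiagonal 3).over K) u ⟨stdLattice K 3, 0, isSelfDualLattice_stdLattice_three_of_v hϖ⟩ ∧
        ((u⁻¹ * γ * u : unitaryGroupOfForm σ ((StdForm.antidiagonal 3).over K)) : GL (Fin 3) K) = endoGL (k₁⁻¹ * B₀ * k₁, (1 : GL (Fin 1) K)) ∧
        (∀ i j, Valued.v (((((k₁⁻¹ * B₀ * k₁ : GL (Fin 2) K)) : Matrix (Fin 2) (Fin 2) K) - 1) i j) ≤ Valued.v ϖ ^ d₀) ∧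
        Valued.v ((ϖ ^ d₀)⁻¹ * (((((k₁⁻¹ * B₀ * k₁ : GL (Fin 2) K)) : Matrix (Fin 2) (Fin 2) K) - 1) 0 0 - ((((k₁⁻¹ * B₀ * k₁ : GL (Fin 2) K)) : Matrix (Fin 2) (Fin 2) K) - 1) 1 1)) < 1 ∧
        (Valued.v ((ϖ ^ d₀)⁻¹ * (((k₁⁻¹ * B₀ * k₁ : GL (Fin 2) K)) : Matrix (Fin 2) (Fin 2) K) 1 0) < 1 ∨
          Valued.v ((ϖ ^ d₀)⁻¹ * (((k₁⁻¹ * B₀ * k₁ : GL (Fin 2) K)) : Matrix (Fin 2) (Fin 2) K) 0 1) < 1) := by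
    intro k₁ hk₁ hvk₁
    let u : unitaryGroupOfForm σ ((StdForm.antidiagonal 3).over K) :=
      ⟨endoGL (k₁, (1 : GL (Fin 1) K)), endoGL_mem_unitaryGroupOfForm_antidiagonal_three hk₁ (Subgroup.one_mem _)⟩
    have hu : (u : GL (Fin 3) K) = endoGL (k₁, (1 : GL (Fin 1) K)) := rfl
    have hvu : v = latticeGraphIso σ ϖ ((StdForm.antidiagonal 3).over K) u ⟨stdLattice K 3, 0, isSelfDualLattice_stdLattice_three_of_v hϖ⟩ := by
      apply Subtype.ext
      rw [latticeGraphIso_apply_coe, hvk₁]; rfl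
    have hγu : ((u⁻¹ * γ * u : unitaryGroupOfForm σ ((StdForm.antidiagonal 3).over K)) : GL (Fin 3) K) = endoGL (k₁⁻¹ * B₀ * k₁, (1 : GL (Fin 1) K)) := by
      rw [Subgroup.coe_mul, Subgroup.coe_mul, Subgroup.coe_inv, hu, hγ, endoGL_one_inv_mul_endoGL_one_mul_endoGL_one]
    -- depth from the region token
    have hvR' := hvR
    rw [hvu] at hvR'
    have hdeep3 := (forall_v_conj_sub_one_le_iff_map_sub_one_le_scaleLattice γ u hϖD0).1 hvR'
    rw [hγu, coe_endoGL_sub_one_eq_endoShape, forall_v_endoShape_le_iff, map_pow] at hdeep3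
    have hdeep := hdeep3.1
    -- the dichotomy (★ (K3))
    have hTint : ∀ i j, Valued.v ((ϖ ^ d₀)⁻¹ * ((((k₁⁻¹ * B₀ * k₁ : GL (Fin 2) K)) : Matrix (Fin 2) (Fin 2) K) - 1) i j) ≤ 1 := fun i j => by
      rw [map_mul, map_inv₀, map_pow]
      calc (Valued.v ϖ ^ d₀)⁻¹ * Valued.v (((((k₁⁻¹ * B₀ * k₁ : GL (Fin 2) K)) : Matrix (Fin 2) (Fin 2) K) - 1) i j) ≤ (Valued.v ϖ ^ d₀)⁻¹ * Valued.v ϖ ^ d₀ :=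
            mul_le_mul' le_rfl (hdeep i j)
        _ = 1 := inv_mul_cancel₀ (pow_ne_zero _ hvϖ0)
    obtain ⟨T, hT⟩ : ∃ T : Matrix (Fin 2) (Fin 2) 𝒪[K], ∀ i j, ((T i j : 𝒪[K]) : K) = (ϖ ^ d₀)⁻¹ * ((((k₁⁻¹ * B₀ * k₁ : GL (Fin 2) K)) : Matrix (Fin 2) (Fin 2) K) - 1) i j :=
      ⟨Matrix.of fun i j => ⟨_, (Valuation.mem_integer_iff _ _).2 (hTint i j)⟩, fun i j => rfl⟩
    have hunit : endoGL (k₁⁻¹ * B₀ * k₁, (1 : GL (Fin 1) K)) ∈ unitaryGroupOfForm σ ((StdForm.antidiagonal 3).over K) := by rw [← hγu]; exact (u⁻¹ * γ * u).2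
    have hdisc₁ : Valued.v ((((k₁⁻¹ * B₀ * k₁ : GL (Fin 2) K)) : Matrix (Fin 2) (Fin 2) K).trace ^ 2 - 4 * (((k₁⁻¹ * B₀ * k₁ : GL (Fin 2) K)) : Matrix (Fin 2) (Fin 2) K).det) <
        Valued.v ϖ ^ (2 * d₀) := by
      rw [Units.val_mul, Units.val_mul, Matrix.trace_units_conj', Matrix.det_units_conj']; exact hdisc
    obtain ⟨hsym, hdich⟩ := residue_apply_eq_and_offDiag_dichotomy_of_unitary_two hvσ hσϖ hϖ hres h2 _ (block_mem_unitary_of_endoGL_mem hunit) hodd T hT hdisc₁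
    have hsymv : Valued.v ((ϖ ^ d₀)⁻¹ * (((((k₁⁻¹ * B₀ * k₁ : GL (Fin 2) K)) : Matrix (Fin 2) (Fin 2) K) - 1) 0 0 - ((((k₁⁻¹ * B₀ * k₁ : GL (Fin 2) K)) : Matrix (Fin 2) (Fin 2) K) - 1) 1 1)) < 1 := by
      have h := hsym
      rw [← sub_eq_zero, ← map_sub, residue_eq_zero_iff_v_lt_one] at h
      simpa [hT, mul_sub] using h
    refine ⟨u, hu, hvu, hγu, hdeep, hsymv, ?_⟩
    rcases hdich with h10 | h01
    · left
      rw [residue_eq_zero_iff_v_lt_one, hT, Matrix.sub_apply, Matrix.one_apply_ne (by decide), sub_zero] at h10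
      exact h10
    · right
      rw [residue_eq_zero_iff_v_lt_one, hT, Matrix.sub_apply, Matrix.one_apply_ne (by decide), sub_zero] at h01
      exact h01
  -- (e) conclude, flipping the W-frame if necessary
  have htrdet : ∀ k₁ : GL (Fin 2) K, (((k₁⁻¹ * B₀ * k₁ : GL (Fin 2) K)) : Matrix (Fin 2) (Fin 2) K).trace = (B₀ : Matrix (Fin 2) (Fin 2) K).trace ∧
      (((k₁⁻¹ * B₀ * k₁ : GL (Fin 2) K)) : Matrix (Fin 2) (Fin 2) K).det = (B₀ : Matrix (Fin 2) (Fin 2) K).det := fun k₁ => by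
    rw [Units.val_mul, Units.val_mul, Matrix.trace_units_conj', Matrix.det_units_conj']; exact ⟨rfl, rfl⟩
  obtain ⟨u, hu, hvu, hγu, hdeep, hsymv, hdich⟩ := key (k : GL (Fin 2) K) k.2 hvk
  rcases hdich with h10 | h01
  · exact ⟨(k : GL (Fin 2) K), k.2, u, hu, hvu, (k : GL (Fin 2) K)⁻¹ * B₀ * (k : GL (Fin 2) K), hγu, (htrdet _).1, (htrdet _).2, hdeep, h10, hsymv⟩
  · -- flip: `k' = k·w₀`
    obtain ⟨w, hw, hw'⟩ := (exists_flipTwo : ∃ w : GL (Fin 2) K, _)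
    have hwU : w ∈ unitaryGroupOfForm σ ((StdForm.antidiagonal 2).over K) := by
      have h := endoGL_flip_one_mem_unitary σ hw
      rw [← endoForm_antidiagonal_over, endoGL_mem_iff] at h
      exact h.1
    have hkw : (k : GL (Fin 2) K) * w ∈ unitaryGroupOfForm σ ((StdForm.antidiagonal 2).over K) := Subgroup.mul_mem _ k.2 hwU
    have hvkw : v.1 = latt ((endoGL ((k : GL (Fin 2) K) * w, (1 : GL (Fin 1) K)) : GL (Fin 3) K) : Matrix (Fin 3) (Fin 3) K) := by
      rw [hvk]
      refine (latt_endoGL_one_eq_iff _ _).2 ?_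
      -- `latt (k w₀) = latt k`: `w₀ ∈ GL₂(𝒪)`
      rw [Units.val_mul, latt_mul]
      have hwl : latt ((w : GL (Fin 2) K) : Matrix (Fin 2) (Fin 2) K) = stdLattice K 2 := by
        apply le_antisymm
        · rw [latt_le_stdLattice_iff, hw]; intro i j; fin_cases i <;> fin_cases j <;> simp
        · have h1 : stdLattice K 2 = latt (((w : GL (Fin 2) K) : Matrix (Fin 2) (Fin 2) K) * ((w : GL (Fin 2) K) : Matrix (Fin 2) (Fin 2) K)) := by
            rw [← Units.val_mul, show w * w = 1 from by
              rw [← inv_eq_iff_mul_eq_one]; exact Units.ext (hw'.trans hw.symm), Units.val_one, latt_one]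
          rw [h1, latt_mul]
          refine Submodule.map_mono ?_
          rw [latt_le_stdLattice_iff, hw]; intro i j; fin_cases i <;> fin_cases j <;> simp
      rw [hwl]; rfl
    obtain ⟨u', hu', hvu', hγu', hdeep', hsymv', hdich'⟩ := key ((k : GL (Fin 2) K) * w) hkw hvkw
    have hre : ((k : GL (Fin 2) K) * w)⁻¹ * B₀ * ((k : GL (Fin 2) K) * w) = w⁻¹ * ((k : GL (Fin 2) K)⁻¹ * B₀ * k) * w := by group
    refine ⟨(k : GL (Fin 2) K) * w, hkw, u', hu', hvu', ((k : GL (Fin 2) K) * w)⁻¹ * B₀ * ((k : GL (Fin 2) K) * w), hγu', (htrdet _).1, (htrdet _).2, hdeep', ?_, hsymv'⟩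
    rw [hre, coe_flip_inv_mul_mul_flip_apply hw hw', show Fin.rev (1 : Fin 2) = 0 from rfl, show Fin.rev (0 : Fin 2) = 1 from rfl]
    exact h01

/-! ## §2 (g2) The scalar key at the top: `res CO = 0` -/

/-- **(g2) THE SCALAR KEY VANISHES AT THE TOP.**  In a J-symmetric block frame (`|ϖ^{−d₀}((g₁−1)₀₀ − (g₁−1)₁₁)| < 1`) with `tr g₁ = 2c` (`|2| = 1`) and the centre TOP-deep
(`|c − 1| ≤ |ϖ^(d₀+1)|`): `|ϖ^{−d₀}(1 − g₁,₀₀)| < 1` (`1 − g₁,₀₀ = −(g₁,₀₀ − c) − (c − 1)`, ★ `apply_sub_centre_eq_of_trace`) — so `res CO = 0` for ★ `blockVertexCensus_top`'s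
`CO = ϖ^{−d₀}(u′₀₀ − g₁,₀₀)`, `u′ = 1`. [cite: Rogawski1990, §4.9 Lemma 4.9.3 p. 56] [cite: Kottwitz1986, §3] -/
theorem v_inv_pow_mul_one_sub_apply_lt_one_of_top (hϖ : Valued.v ϖ = WithZero.exp (-1 : ℤ)) (h2 : Valued.v (2 : K) = 1)
    (g₁ : Matrix (Fin 2) (Fin 2) K) {c : K} (hc : g₁.trace = 2 * c) {d₀ : ℕ}
    (hsym : Valued.v ((ϖ ^ d₀)⁻¹ * (((g₁ - 1) 0 0) - ((g₁ - 1) 1 1))) < 1) (hα : Valued.v (c - 1) ≤ Valued.v (ϖ ^ (d₀ + 1))) :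
    Valued.v ((ϖ ^ d₀)⁻¹ * ((((1 : GL (Fin 1) K) : Matrix (Fin 1) (Fin 1) K) 0 0) - g₁ 0 0)) < 1 := by
  have hϖ0 : ϖ ≠ 0 := fun h0 => by rw [h0, map_zero] at hϖ; exact WithZero.coe_ne_zero hϖ.symm
  have hvϖ0 : Valued.v ϖ ≠ 0 := (Valuation.ne_zero_iff _).2 hϖ0
  have hϖlt : Valued.v ϖ < 1 := by rw [hϖ, ← WithZero.exp_zero]; exact WithZero.exp_lt_exp.2 (by norm_num)
  have h20 : (2 : K) ≠ 0 := fun h0 => by rw [h0, map_zero] at h2; exact zero_ne_one h2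
  have hv2 : Valued.v ((2 : K)⁻¹) = 1 := by rw [map_inv₀, h2, inv_one]
  have e : (ϖ ^ d₀)⁻¹ * ((((1 : GL (Fin 1) K) : Matrix (Fin 1) (Fin 1) K) 0 0) - g₁ 0 0) =
      -((2 : K)⁻¹ * ((ϖ ^ d₀)⁻¹ * (((g₁ - 1) 0 0) - ((g₁ - 1) 1 1)))) - (ϖ ^ d₀)⁻¹ * (c - 1) := by
    rw [Units.val_one, Matrix.one_apply_eq, show (1 : K) - g₁ 0 0 = -(g₁ 0 0 - c) - (c - 1) by ring, (apply_sub_centre_eq_of_trace h20 g₁ hc).1]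
    ring
  rw [e]
  refine (Valuation.map_sub _ _ _).trans_lt (max_lt ?_ ?_)
  · rw [Valuation.map_neg, map_mul, hv2, one_mul]; exact hsym
  · rw [map_mul, map_inv₀, map_pow]
    calc (Valued.v ϖ ^ d₀)⁻¹ * Valued.v (c - 1) ≤ (Valued.v ϖ ^ d₀)⁻¹ * Valued.v (ϖ ^ (d₀ + 1)) := mul_le_mul' le_rfl hα
      _ = Valued.v ϖ := by rw [map_pow, pow_succ, ← mul_assoc, inv_mul_cancel₀ (pow_ne_zero _ hvϖ0), one_mul]
      _ < 1 := hϖlt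

/-! ## §3 (g3) + assembly: the per-vertex census at the top root vertices -/

set_option maxHeartbeats 3200000 in
-- budget only: statement-heavy lattice tokens (the ★ (4a) token texts, three kinds, and the frame bookkeeping per vertex).
/-- **THE PER-VERTEX CENSUS AT THE TOP ROOT VERTICES OF `γ = ι(B₀, 1)` (regime A-even).**  For `B₀ ∈ U(σ, !![0,1;1,0])` DEEP of odd depth `d₀ ≥ 3` (`|(B₀−1)ᵢⱼ| ≤ |ϖ|^{d₀}`),
`|tr² − 4det|(B₀) < |ϖ|^{2d₀}`, TOP (`|½tr B₀ − 1| ≤ |ϖ^(d₀+1)|`, empty centred top `W`-ball `htop`), finite root region `R`, class constants `c₁ ε` and `nc₁ = −c₁`: at every `v ∈ R`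
**`#E(v) = 0`**, and for the centred kind `Q v :≡ ¬Pin v ∧ Qbig_(nc₁) v` (F0P3a-p08 (g21)∕A-p12 (g25) token texts): **`Q v → #P(v) = q² ∧ #M(v) = 0`**, **`¬Q v → #P(v) = 0 ∧ #M(v) = q²`**
(`q = Fintype.card 𝓀[K]`).  Per vertex: `e₁ ∈ v.1` (★ p849253) ⇒ §1 frame ⇒ keys `res CO = 0` (§2) and `res LO ≠ 0` (no inner top vertex: ★ p849492 + `htop` + ★
`inner_token_iff_of_axisFrame`) ⇒ values ★ `blockVertexCensus_top` `(0, q·q·[χ(c₀l̄)=1], q·q·[χ(c₀l̄)=−1])` (`c₀ = (res nc₁)⁻¹`) ⇒ kind link ★ `big_token_iff_of_axisFrame` at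
`(CO, T₀) := (−nc₁, nc₁)`: `Qbig_(nc₁) v ⟺ χ(l̄·n̄c₁) = 1 = χ(c₀l̄)`. [cite: Kottwitz1986, §3] [cite: Rogawski1990, §4.9 Prop. 4.9.1 (b) p. 55, Lemma 4.9.3 p. 56]
[cite: LabesseLanglands1979, §2 Lemma 2.1 p. 8] [cite: BruhatTits1972, §10] -/
theorem hyperbolicVertexCensus_top [IsPrincipalIdealRing 𝒪[K]]
    (hσ : ∀ x, σ (σ x) = x) (hvσ : ∀ a, Valued.v (σ a) = Valued.v a) (hσϖ : σ ϖ = -ϖ)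
    (hϖ : Valued.v ϖ = WithZero.exp (-1 : ℤ)) (hres : ∀ x : K, Valued.v x ≤ 1 → Valued.v (σ x - x) < 1) (h2 : Valued.v (2 : K) = 1)
    (hnorm : ∀ u : K, σ u = u → Valued.v (u - 1) < 1 → ∃ z : K, z * σ z = u ∧ Valued.v (z - 1) ≤ Valued.v (u - 1))
    [Fintype 𝓀[K]] [DecidableEq 𝓀[K]] [ValuativeRel K] [(Valued.v : Valuation K ℤᵐ⁰).Compatible]
    (γ : unitaryGroupOfForm σ ((StdForm.antidiagonal 3).over K)) (B₀ : GL (Fin 2) K) (hγ : (γ : GL (Fin 3) K) = endoGL (B₀, (1 : GL (Fin 1) K)))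
    (hγU : B₀ ∈ unitaryGroupOfForm σ (!![(0 : K), 1; 1, 0] : Matrix (Fin 2) (Fin 2) K))
    {d₀ : ℕ} (hd3 : 3 ≤ d₀) (hodd : Odd d₀)
    (hBm : ∀ i j, Valued.v (((B₀ : Matrix (Fin 2) (Fin 2) K) - 1) i j) ≤ Valued.v ϖ ^ d₀)
    (hdisc : Valued.v ((B₀ : Matrix (Fin 2) (Fin 2) K).trace ^ 2 - 4 * (B₀ : Matrix (Fin 2) (Fin 2) K).det) < Valued.v ϖ ^ (2 * d₀))
    (hα : Valued.v ((B₀ : Matrix (Fin 2) (Fin 2) K).trace / 2 - 1) ≤ Valued.v (ϖ ^ (d₀ + 1)))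
    (htop : {B : Submodule 𝒪[K] (Fin 2 → K) | IsSelfDualLattice σ ϖ (!![(0 : K), 1; 1, 0] : Matrix (Fin 2) (Fin 2) K) B ∧ mapGL B₀ B = B ∧
        B.map ((Matrix.toLin' ((B₀ : Matrix (Fin 2) (Fin 2) K) - ((B₀ : Matrix (Fin 2) (Fin 2) K).trace / 2) • (1 : Matrix (Fin 2) (Fin 2) K))).restrictScalars 𝒪[K]) ≤
          scaleLattice (ϖ ^ (d₀ + 1)) B} = ∅)
    (hRfin : Set.Finite {v : {M : Submodule 𝒪[K] (Fin 3 → K) // IsVertex σ ϖ ((StdForm.antidiagonal 3).over K) M} | latticeGraphIso σ ϖ ((StdForm.antidiagonal 3).over K) γ v = v ∧ IsSelfDualLattice σ ϖ ((StdForm.antidiagonal 3).over K) v.1 ∧ v.1.map ((Matrix.toLin' (((γ : GL (Fin 3) K) : Matrix (Fin 3) (Fin 3) K) - 1)).restrictScalars 𝒪[K]) ≤ scaleLattice (ϖ ^ d₀) v.1})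
    (c₁ ε : K) (hc₁ : Valued.v c₁ = 1) (hεv : Valued.v ε = 1) (hε : ∀ z : K, Valued.v z ≤ 1 → Valued.v (z ^ 2 - ε) = 1)
    (nc₁ : 𝒪[K]) (hnc₁ : (nc₁ : K) = -c₁) :
    ∀ v ∈ {v : {M : Submodule 𝒪[K] (Fin 3 → K) // IsVertex σ ϖ ((StdForm.antidiagonal 3).over K) M} | latticeGraphIso σ ϖ ((StdForm.antidiagonal 3).over K) γ v = v ∧ IsSelfDualLattice σ ϖ ((StdForm.antidiagonal 3).over K) v.1 ∧ v.1.map ((Matrix.toLin' (((γ : GL (Fin 3) K) : Matrix (Fin 3) (Fin 3) K) - 1)).restrictScalars 𝒪[K]) ≤ scaleLattice (ϖ ^ d₀) v.1},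
      ({w | w ∈ {w | ∃ c, ((latticeGraph σ ϖ ((StdForm.antidiagonal 3).over K)).Adj v c ∧ (latticeGraph σ ϖ ((StdForm.antidiagonal 3).over K)).dist ⟨stdLattice K 3, 0, isSelfDualLattice_stdLattice_three_of_v hϖ⟩ c = (latticeGraph σ ϖ ((StdForm.antidiagonal 3).over K)).dist ⟨stdLattice K 3, 0, isSelfDualLattice_stdLattice_three_of_v hϖ⟩ v + 1 ∧ latticeGraphIso σ ϖ ((StdForm.antidiagonal 3).over K) γ c = c) ∧ ((latticeGraph σ ϖ ((StdForm.antidiagonal 3).over K)).Adj c w ∧ (latticeGraph σ ϖ ((StdForm.antidiagonal 3).over K)).dist ⟨stdLattice K 3, 0, isSelfDualLattice_stdLattice_three_of_v hϖ⟩ w = (latticeGraph σ ϖ ((StdForm.antidiagonal 3).over K)).dist ⟨stdLattice K 3, 0, isSelfDualLattice_stdLattice_three_of_v hϖ⟩ c + 1 ∧ latticeGraphIso σ ϖ ((StdForm.antidiagonal 3).over K) γ w = w)} ∧ (¬ w.1.map ((Matrix.toLin' (((γ : GL (Fin 3) K) : Matrix (Fin 3) (Fin 3) K) - 1)).restrictScalars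 𝒪[K]) ≤ scaleLattice (ϖ ^ d₀) w.1 ∧ (w.1.map ((Matrix.toLin' (((γ : GL (Fin 3) K) : Matrix (Fin 3) (Fin 3) K) - 1)).restrictScalars 𝒪[K]) ≤ scaleLattice (ϖ ^ (d₀ - 1)) w.1 ∧ ¬ w.1.map ((Matrix.toLin' (((γ : GL (Fin 3) K) : Matrix (Fin 3) (Fin 3) K) - 1)).restrictScalars 𝒪[K]) ≤ scaleLattice (ϖ ^ d₀) w.1))}).ncard = 0 ∧
      ((¬ (∀ y ∈ v.1, y 1 = 0 → ((((γ : GL (Fin 3) K) : Matrix (Fin 3) (Fin 3) K) - ((B₀ : Matrix (Fin 2) (Fin 2) K).trace / 2) • (1 : Matrix (Fin 3) (Fin 3) K)) *ᵥ y) ∈ scaleLattice (ϖ ^ (d₀ + 1)) v.1) ∧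
        ∃ y ∈ v.1, y 1 = 0 ∧ ∃ a : K, Valued.v a = 1 ∧ Valued.v ((ϖ ^ d₀)⁻¹ * pairing σ ((StdForm.antidiagonal 3).over K) y ((((γ : GL (Fin 3) K) : Matrix (Fin 3) (Fin 3) K) - ((B₀ : Matrix (Fin 2) (Fin 2) K).trace / 2) • (1 : Matrix (Fin 3) (Fin 3) K)) *ᵥ y) - (nc₁ : K) * a ^ 2) < 1) →
        ({w | w ∈ {w | ∃ c, ((latticeGraph σ ϖ ((StdForm.antidiagonal 3).over K)).Adj v c ∧ (latticeGraph σ ϖ ((StdForm.antidiagonal 3).over K)).dist ⟨stdLattice K 3, 0, isSelfDualLattice_stdLattice_three_of_v hϖ⟩ c = (latticeGraph σ ϖ ((StdForm.antidiagonal 3).over K)).dist ⟨stdLattice K 3, 0, isSelfDualLattice_stdLattice_three_of_v hϖ⟩ v + 1 ∧ latticeGraphIso σ ϖ ((StdForm.antidiagonal 3).over K) γ c = c) ∧ ((latticeGraph σ ϖ ((StdForm.antidiagonal 3).over K)).Adj c w ∧ (latticeGraph σ ϖ ((StdForm.antidiagonal 3).over K)).dist ⟨stdLattice K 3, 0, isSelfDualLattice_stdLattice_three_of_v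 hϖ⟩ w = (latticeGraph σ ϖ ((StdForm.antidiagonal 3).over K)).dist ⟨stdLattice K 3, 0, isSelfDualLattice_stdLattice_three_of_v hϖ⟩ c + 1 ∧ latticeGraphIso σ ϖ ((StdForm.antidiagonal 3).over K) γ w = w)} ∧ (¬ w.1.map ((Matrix.toLin' (((γ : GL (Fin 3) K) : Matrix (Fin 3) (Fin 3) K) - 1)).restrictScalars 𝒪[K]) ≤ scaleLattice (ϖ ^ d₀) w.1 ∧ (w.1.map ((Matrix.toLin' (((γ : GL (Fin 3) K) : Matrix (Fin 3) (Fin 3) K) - 1)).restrictScalars 𝒪[K]) ≤ scaleLattice (ϖ ^ (d₀ - 2)) w.1 ∧ ¬ w.1.map ((Matrix.toLin' (((γ : GL (Fin 3) K) : Matrix (Fin 3) (Fin 3) K) - 1)).restrictScalars 𝒪[K]) ≤ scaleLattice (ϖ ^ (d₀ - 1)) w.1) ∧ ∃ y ∈ w.1, ∃ a : K, Valued.v a = 1 ∧ Valued.v ((ϖ ^ (d₀ - 2))⁻¹ * pairing σ ((StdForm.antidiagonal 3).over K) y ((((γ : GL (Fin 3) K) : Matrix (Fin 3) (Fin 3)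 K) - 1) *ᵥ y) - (c₁) * a ^ 2) < 1)}).ncard = Fintype.card 𝓀[K] ^ 2 ∧
        ({w | w ∈ {w | ∃ c, ((latticeGraph σ ϖ ((StdForm.antidiagonal 3).over K)).Adj v c ∧ (latticeGraph σ ϖ ((StdForm.antidiagonal 3).over K)).dist ⟨stdLattice K 3, 0, isSelfDualLattice_stdLattice_three_of_v hϖ⟩ c = (latticeGraph σ ϖ ((StdForm.antidiagonal 3).over K)).dist ⟨stdLattice K 3, 0, isSelfDualLattice_stdLattice_three_of_v hϖ⟩ v + 1 ∧ latticeGraphIso σ ϖ ((StdForm.antidiagonal 3).over K) γ c = c) ∧ ((latticeGraph σ ϖ ((StdForm.antidiagonal 3).over K)).Adj c w ∧ (latticeGraph σ ϖ ((StdForm.antidiagonal 3).over K)).dist ⟨stdLattice K 3, 0, isSelfDualLattice_stdLattice_three_of_v hϖ⟩ w = (latticeGraph σ ϖ ((StdForm.antidiagonal 3).over K)).dist ⟨stdLattice K 3, 0, isSelfDualLattice_stdLattice_three_of_v hϖ⟩ c + 1 ∧ latticeGraphIso σ ϖ ((StdForm.antidiagonal 3).over K) γ w = w)} ∧ (¬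 w.1.map ((Matrix.toLin' (((γ : GL (Fin 3) K) : Matrix (Fin 3) (Fin 3) K) - 1)).restrictScalars 𝒪[K]) ≤ scaleLattice (ϖ ^ d₀) w.1 ∧ (w.1.map ((Matrix.toLin' (((γ : GL (Fin 3) K) : Matrix (Fin 3) (Fin 3) K) - 1)).restrictScalars 𝒪[K]) ≤ scaleLattice (ϖ ^ (d₀ - 2)) w.1 ∧ ¬ w.1.map ((Matrix.toLin' (((γ : GL (Fin 3) K) : Matrix (Fin 3) (Fin 3) K) - 1)).restrictScalars 𝒪[K]) ≤ scaleLattice (ϖ ^ (d₀ - 1)) w.1) ∧ ¬ (∃ y ∈ w.1, ∃ a : K, Valued.v a = 1 ∧ Valued.v ((ϖ ^ (d₀ - 2))⁻¹ * pairing σ ((StdForm.antidiagonal 3).over K) y ((((γ : GL (Fin 3) K) : Matrix (Fin 3) (Fin 3) K) - 1) *ᵥ y) - (c₁) * a ^ 2) < 1))}).ncard = 0) ∧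
      (¬ (¬ (∀ y ∈ v.1, y 1 = 0 → ((((γ : GL (Fin 3) K) : Matrix (Fin 3) (Fin 3) K) - ((B₀ : Matrix (Fin 2) (Fin 2) K).trace / 2) • (1 : Matrix (Fin 3) (Fin 3) K)) *ᵥ y) ∈ scaleLattice (ϖ ^ (d₀ + 1)) v.1) ∧
        ∃ y ∈ v.1, y 1 = 0 ∧ ∃ a : K, Valued.v a = 1 ∧ Valued.v ((ϖ ^ d₀)⁻¹ * pairing σ ((StdForm.antidiagonal 3).over K) y ((((γ : GL (Fin 3) K) : Matrix (Fin 3) (Fin 3) K) - ((B₀ : Matrix (Fin 2) (Fin 2) K).trace / 2) • (1 : Matrix (Fin 3) (Fin 3) K)) *ᵥ y) - (nc₁ : K) * a ^ 2) < 1) →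
        ({w | w ∈ {w | ∃ c, ((latticeGraph σ ϖ ((StdForm.antidiagonal 3).over K)).Adj v c ∧ (latticeGraph σ ϖ ((StdForm.antidiagonal 3).over K)).dist ⟨stdLattice K 3, 0, isSelfDualLattice_stdLattice_three_of_v hϖ⟩ c = (latticeGraph σ ϖ ((StdForm.antidiagonal 3).over K)).dist ⟨stdLattice K 3, 0, isSelfDualLattice_stdLattice_three_of_v hϖ⟩ v + 1 ∧ latticeGraphIso σ ϖ ((StdForm.antidiagonal 3).over K) γ c = c) ∧ ((latticeGraph σ ϖ ((StdForm.antidiagonal 3).over K)).Adj c w ∧ (latticeGraph σ ϖ ((StdForm.antidiagonal 3).over K)).dist ⟨stdLattice K 3, 0, isSelfDualLattice_stdLattice_three_of_v hϖ⟩ w = (latticeGraph σ ϖ ((StdForm.antidiagonal 3).over K)).dist ⟨stdLattice K 3, 0, isSelfDualLattice_stdLattice_three_of_v hϖ⟩ c + 1 ∧ latticeGraphIso σ ϖ ((StdForm.antidiagonal 3).over K) γ w = w)} ∧ (¬ w.1.map ((Matrix.toLin' (((γ : GL (Fin 3) K) : Matrix (Fin 3) (Fin 3) K) - 1)).restrictScalars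 𝒪[K]) ≤ scaleLattice (ϖ ^ d₀) w.1 ∧ (w.1.map ((Matrix.toLin' (((γ : GL (Fin 3) K) : Matrix (Fin 3) (Fin 3) K) - 1)).restrictScalars 𝒪[K]) ≤ scaleLattice (ϖ ^ (d₀ - 2)) w.1 ∧ ¬ w.1.map ((Matrix.toLin' (((γ : GL (Fin 3) K) : Matrix (Fin 3) (Fin 3) K) - 1)).restrictScalars 𝒪[K]) ≤ scaleLattice (ϖ ^ (d₀ - 1)) w.1) ∧ ∃ y ∈ w.1, ∃ a : K, Valued.v a = 1 ∧ Valued.v ((ϖ ^ (d₀ - 2))⁻¹ * pairing σ ((StdForm.antidiagonal 3).over K) y ((((γ : GL (Fin 3) K) : Matrix (Fin 3) (Fin 3) K) - 1) *ᵥ y) - (c₁) * a ^ 2) < 1)}).ncard = 0 ∧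
        ({w | w ∈ {w | ∃ c, ((latticeGraph σ ϖ ((StdForm.antidiagonal 3).over K)).Adj v c ∧ (latticeGraph σ ϖ ((StdForm.antidiagonal 3).over K)).dist ⟨stdLattice K 3, 0, isSelfDualLattice_stdLattice_three_of_v hϖ⟩ c = (latticeGraph σ ϖ ((StdForm.antidiagonal 3).over K)).dist ⟨stdLattice K 3, 0, isSelfDualLattice_stdLattice_three_of_v hϖ⟩ v + 1 ∧ latticeGraphIso σ ϖ ((StdForm.antidiagonal 3).over K) γ c = c) ∧ ((latticeGraph σ ϖ ((StdForm.antidiagonal 3).over K)).Adj c w ∧ (latticeGraph σ ϖ ((StdForm.antidiagonal 3).over K)).dist ⟨stdLattice K 3, 0, isSelfDualLattice_stdLattice_three_of_v hϖ⟩ w = (latticeGraph σ ϖ ((StdForm.antidiagonal 3).over K)).dist ⟨stdLattice K 3, 0, isSelfDualLattice_stdLattice_three_of_v hϖ⟩ c + 1 ∧ latticeGraphIso σ ϖ ((StdForm.antidiagonal 3).over K) γ w = w)} ∧ (¬ w.1.map ((Matrix.toLin' (((γ : GL (Fin 3) K) : Matrix (Fin 3) (Fin 3) K) - 1)).restrictScalars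 𝒪[K]) ≤ scaleLattice (ϖ ^ d₀) w.1 ∧ (w.1.map ((Matrix.toLin' (((γ : GL (Fin 3) K) : Matrix (Fin 3) (Fin 3) K) - 1)).restrictScalars 𝒪[K]) ≤ scaleLattice (ϖ ^ (d₀ - 2)) w.1 ∧ ¬ w.1.map ((Matrix.toLin' (((γ : GL (Fin 3) K) : Matrix (Fin 3) (Fin 3) K) - 1)).restrictScalars 𝒪[K]) ≤ scaleLattice (ϖ ^ (d₀ - 1)) w.1) ∧ ¬ (∃ y ∈ w.1, ∃ a : K, Valued.v a = 1 ∧ Valued.v ((ϖ ^ (d₀ - 2))⁻¹ * pairing σ ((StdForm.antidiagonal 3).over K) y ((((γ : GL (Fin 3) K) : Matrix (Fin 3) (Fin 3) K) - 1) *ᵥ y) - (c₁) * a ^ 2) < 1))}).ncard = Fintype.card 𝓀[K] ^ 2) := by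
  have hϖ0 : ϖ ≠ 0 := fun h0 => by rw [h0, map_zero] at hϖ; exact WithZero.coe_ne_zero hϖ.symm
  have hvϖ0 : Valued.v ϖ ≠ 0 := (Valuation.ne_zero_iff _).2 hϖ0
  have hϖlt : Valued.v ϖ < 1 := by rw [hϖ, ← WithZero.exp_zero]; exact WithZero.exp_lt_exp.2 (by norm_num)
  have hϖD0 : (ϖ ^ d₀ : K) ≠ 0 := pow_ne_zero _ hϖ0
  have h20 : (2 : K) ≠ 0 := fun h0 => by rw [h0, map_zero] at h2; exact zero_ne_one h2
  have hT := isTree_latticeGraph_three_of_neg hσ hvσ hϖ hσϖ hres h2 hnorm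
  -- `γ ∈ K₀`, `hroot`, `hnil3` (block literal bookkeeping, ★ FILE 1 ∕ ★ NilpotencyTokenOfDepths)
  have hγ2 : endoGL (B₀, (1 : GL (Fin 1) K)) ∈ unitaryGroupOfForm σ ((StdForm.antidiagonal 3).over K) := by rw [← hγ]; exact γ.2
  have hγ0 : γ ∈ unitaryInt σ ((StdForm.antidiagonal 3).over K) := by
    have h := endoGL_one_mem_unitaryInt (σ := σ) hϖlt hγ2 (d := d₀) (by omega) hBm
    have e : γ = ⟨endoGL (B₀, (1 : GL (Fin 1) K)), hγ2⟩ := Subtype.ext hγ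
    rw [e]; exact h
  have hroot : (stdLattice K 3).map ((Matrix.toLin' (((γ : GL (Fin 3) K) : Matrix (Fin 3) (Fin 3) K) - 1)).restrictScalars 𝒪[K]) ≤ scaleLattice (ϖ ^ d₀) (stdLattice K 3) := by
    rw [hγ]; exact map_sub_one_stdLattice_le_scaleLattice_endoGL_one hϖ0 hBm
  have hchar : (((γ : GL (Fin 3) K) : Matrix (Fin 3) (Fin 3) K)).charpoly = (X - C 1) * (B₀ : Matrix (Fin 2) (Fin 2) K).charpoly := by
    rw [hγ]; exact charpoly_coe_endoGL_one B₀
  have hnil3 : ∀ (w : {M : Submodule 𝒪[K] (Fin 3 → K) // IsVertex σ ϖ ((StdForm.antidiagonal 3).over K) M}) (e : ℕ), e + 1 ≤ d₀ →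
      w.1.map ((Matrix.toLin' (((γ : GL (Fin 3) K) : Matrix (Fin 3) (Fin 3) K) - 1)).restrictScalars 𝒪[K]) ≤ scaleLattice (ϖ ^ e) w.1 →
      w.1.map ((Matrix.toLin' ((((γ : GL (Fin 3) K) : Matrix (Fin 3) (Fin 3) K) - 1) ^ 3)).restrictScalars 𝒪[K]) ≤ scaleLattice (ϖ ^ (3 * e + 1)) w.1 := by
    intro w e he hlev
    refine map_sub_one_pow_three_le_scaleLattice_of_charpoly_block_antidiagonal hϖ hchar (d := e) (by rw [sub_self, map_zero]; exact zero_le)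
      (fun i j => (hBm i j).trans ?_) w hlev
    exact pow_le_pow_right_of_le_one' hϖlt.le he
  -- no top root vertex is INNER (★ p849492 + the empty top ball)
  have hinner0 : {v : {M : Submodule 𝒪[K] (Fin 3 → K) // IsVertex σ ϖ ((StdForm.antidiagonal 3).over K) M} | v ∈ {v : {M : Submodule 𝒪[K] (Fin 3 → K) // IsVertex σ ϖ ((StdForm.antidiagonal 3).over K) M} | latticeGraphIso σ ϖ ((StdForm.antidiagonal 3).over K) γ v = v ∧ IsSelfDualLattice σ ϖ ((StdForm.antidiagonal 3).over K) v.1 ∧ v.1.map ((Matrix.toLin' (((γ : GL (Fin 3) K) : Matrix (Fin 3) (Fin 3) K) - 1)).restrictScalars 𝒪[K]) ≤ scaleLattice (ϖ ^ d₀) v.1} ∧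
      ∀ y ∈ v.1, y 1 = 0 → ((((γ : GL (Fin 3) K) : Matrix (Fin 3) (Fin 3) K) - ((B₀ : Matrix (Fin 2) (Fin 2) K).trace / 2) • (1 : Matrix (Fin 3) (Fin 3) K)) *ᵥ y) ∈ scaleLattice (ϖ ^ (d₀ + 1)) v.1} = ∅ := by
    refine (Set.ncard_eq_zero (hRfin.subset fun v hv => hv.1)).1 ?_
    rw [ncard_rootRegion_inner_eq_ncard_two_of_top hσ hvσ hϖ γ B₀ hγ h2 hγU hα htop]
    refine le_antisymm ?_ (Nat.zero_le _)
    calc _ ≤ ({B : Submodule 𝒪[K] (Fin 2 → K) | IsSelfDualLattice σ ϖ (!![(0 : K), 1; 1, 0] : Matrix (Fin 2) (Fin 2) K) B ∧ mapGL B₀ B = B ∧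
        B.map ((Matrix.toLin' ((B₀ : Matrix (Fin 2) (Fin 2) K) - ((B₀ : Matrix (Fin 2) (Fin 2) K).trace / 2) • (1 : Matrix (Fin 2) (Fin 2) K))).restrictScalars 𝒪[K]) ≤
          scaleLattice (ϖ ^ (d₀ + 1)) B}).ncard := Set.ncard_le_ncard (fun B hB => ⟨hB.1, hB.2.1, hB.2.2.2⟩) (by rw [htop]; exact Set.finite_empty)
      _ = 0 := by rw [htop, Set.ncard_empty]
  -- the class constant in `𝒪` and the character bookkeeping
  have hnc₁v : Valued.v (nc₁ : K) = 1 := by rw [hnc₁, Valuation.map_neg, hc₁]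
  have hnc0 : IsLocalRing.residue 𝒪[K] nc₁ ≠ 0 := residue_ne_zero_of_v_eq_one nc₁ hnc₁v
  have htr2 : (B₀ : Matrix (Fin 2) (Fin 2) K).trace = 2 * ((B₀ : Matrix (Fin 2) (Fin 2) K).trace / 2) := by field_simp
  intro v hv
  obtain ⟨hfix, hSD, hlev⟩ := hv
  -- (g1) the frame
  have he : (Pi.single 1 1 : Fin 3 → K) ∈ v.1 :=
    single_one_one_mem_of_mem_rootRegion_of_top hσ hvσ hϖ h2 γ B₀ 1 hγ hγU (by rw [Units.val_one, Matrix.one_apply_eq]; exact hα) htop v ⟨hfix, hSD, hlev⟩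
  obtain ⟨k, hk, u, hu, hvu, g₁, hγu, htr, hdet, hdeep, hadapt, hsym⟩ :=
    exists_adaptedAxisFrame_of_single_one_one_mem hσ hvσ hσϖ hϖ hres h2 γ B₀ hγ hodd hdisc hSD hlev he
  have hc : (g₁ : Matrix (Fin 2) (Fin 2) K).trace = 2 * ((B₀ : Matrix (Fin 2) (Fin 2) K).trace / 2) := by rw [htr]; exact htr2
  -- (g2) the keys `res CO = 0`, `res LO ≠ 0`
  have hCOv := v_inv_pow_mul_one_sub_apply_lt_one_of_top hϖ h2 (g₁ : Matrix (Fin 2) (Fin 2) K) hc hsym hα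
  set CO : 𝒪[K] := ⟨_, (Valuation.mem_integer_iff _ _).2 hCOv.le⟩ with hCOdef
  have hCO : (CO : K) = (ϖ ^ d₀)⁻¹ * ((((1 : GL (Fin 1) K) : Matrix (Fin 1) (Fin 1) K) 0 0) - (g₁ : Matrix (Fin 2) (Fin 2) K) 0 0) := rfl
  have hcres : IsLocalRing.residue 𝒪[K] CO = 0 := (residue_eq_zero_iff_v_lt_one CO).2 hCOv
  have hLOv : Valued.v ((ϖ ^ d₀)⁻¹ * (g₁ : Matrix (Fin 2) (Fin 2) K) 0 1) ≤ 1 := by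
    rw [map_mul, map_inv₀, map_pow, show (g₁ : Matrix (Fin 2) (Fin 2) K) 0 1 = ((g₁ : Matrix (Fin 2) (Fin 2) K) - 1) 0 1 by
      rw [Matrix.sub_apply, Matrix.one_apply_ne (by decide), sub_zero]]
    calc (Valued.v ϖ ^ d₀)⁻¹ * Valued.v (((g₁ : Matrix (Fin 2) (Fin 2) K) - 1) 0 1) ≤ (Valued.v ϖ ^ d₀)⁻¹ * Valued.v ϖ ^ d₀ := mul_le_mul' le_rfl (hdeep 0 1)
      _ = 1 := inv_mul_cancel₀ (pow_ne_zero _ hvϖ0)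
  set LO : 𝒪[K] := ⟨_, (Valuation.mem_integer_iff _ _).2 hLOv⟩ with hLOdef
  have hLO : (LO : K) = (ϖ ^ d₀)⁻¹ * (g₁ : Matrix (Fin 2) (Fin 2) K) 0 1 := rfl
  have hPin_iff := inner_token_iff_of_axisFrame hϖ h2 γ u k hu hvu g₁ hγu hc hadapt hsym
  have hnotPin : ¬ (∀ y ∈ v.1, y 1 = 0 → ((((γ : GL (Fin 3) K) : Matrix (Fin 3) (Fin 3) K) - ((B₀ : Matrix (Fin 2) (Fin 2) K).trace / 2) • (1 : Matrix (Fin 3) (Fin 3) K)) *ᵥ y) ∈ scaleLattice (ϖ ^ (d₀ + 1)) v.1) := fun hPin => by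
    have hmem : v ∈ ({v : {M : Submodule 𝒪[K] (Fin 3 → K) // IsVertex σ ϖ ((StdForm.antidiagonal 3).over K) M} | v ∈ {v : {M : Submodule 𝒪[K] (Fin 3 → K) // IsVertex σ ϖ ((StdForm.antidiagonal 3).over K) M} | latticeGraphIso σ ϖ ((StdForm.antidiagonal 3).over K) γ v = v ∧ IsSelfDualLattice σ ϖ ((StdForm.antidiagonal 3).over K) v.1 ∧ v.1.map ((Matrix.toLin' (((γ : GL (Fin 3) K) : Matrix (Fin 3) (Fin 3) K) - 1)).restrictScalars 𝒪[K]) ≤ scaleLattice (ϖ ^ d₀) v.1} ∧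
      ∀ y ∈ v.1, y 1 = 0 → ((((γ : GL (Fin 3) K) : Matrix (Fin 3) (Fin 3) K) - ((B₀ : Matrix (Fin 2) (Fin 2) K).trace / 2) • (1 : Matrix (Fin 3) (Fin 3) K)) *ᵥ y) ∈ scaleLattice (ϖ ^ (d₀ + 1)) v.1}) := ⟨⟨hfix, hSD, hlev⟩, hPin⟩
    rw [hinner0] at hmem
    exact (Set.mem_empty_iff_false v).1 hmem
  have hl : IsLocalRing.residue 𝒪[K] LO ≠ 0 := fun h0 => hnotPin (hPin_iff.2 ((residue_eq_zero_iff_v_lt_one LO).1 h0))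
  -- the values (★ `blockVertexCensus_top`)
  obtain ⟨hE, hP, hM⟩ := blockVertexCensus_top hσ hvσ hσϖ hϖ hres h2 hnorm hT hγ0 hd3 hodd hnil3 hroot c₁ ε hc₁ hεv hε nc₁ hnc₁ u hvu hSD hfix hlev g₁ 1 hγu
    hadapt hsym CO hCO hcres LO hLO hl
  -- (g3) the kind link: `Qbig_(nc₁) v ⟺ χ(l̄·n̄c₁) = 1`, and `χ((res nc₁)⁻¹·l̄) = χ(l̄·n̄c₁)`
  have hbig := big_token_iff_of_axisFrame hvσ hϖ hres h2 γ u k hu hvu g₁ hγu hc hadapt hsym (-nc₁) nc₁ (by rw [map_neg]) hnc0 LO hLO hl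
  rw [(IsLocalRing.residue 𝒪[K]).map_neg nc₁, mul_neg, neg_neg] at hbig
  have hχeq : quadraticChar 𝓀[K] ((IsLocalRing.residue 𝒪[K] nc₁)⁻¹ * IsLocalRing.residue 𝒪[K] LO) =
      quadraticChar 𝓀[K] (IsLocalRing.residue 𝒪[K] LO * IsLocalRing.residue 𝒪[K] nc₁) := by
    have hsq : quadraticChar 𝓀[K] (((IsLocalRing.residue 𝒪[K] nc₁)⁻¹) ^ 2) = 1 := quadraticChar_sq_one' (inv_ne_zero hnc0)
    rw [show (IsLocalRing.residue 𝒪[K] nc₁)⁻¹ * IsLocalRing.residue 𝒪[K] LO =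
      (IsLocalRing.residue 𝒪[K] LO * IsLocalRing.residue 𝒪[K] nc₁) * ((IsLocalRing.residue 𝒪[K] nc₁)⁻¹) ^ 2 by field_simp, map_mul, hsq, mul_one]
  have hne : IsLocalRing.residue 𝒪[K] LO * IsLocalRing.residue 𝒪[K] nc₁ ≠ 0 := mul_ne_zero hl hnc0
  rw [hχeq] at hP hM
  refine ⟨hE, fun hQ => ?_, fun hnQ => ?_⟩
  · have h1 : quadraticChar 𝓀[K] (IsLocalRing.residue 𝒪[K] LO * IsLocalRing.residue 𝒪[K] nc₁) = 1 := hbig.1 hQ.2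
    have hm1 : ¬ quadraticChar 𝓀[K] (IsLocalRing.residue 𝒪[K] LO * IsLocalRing.residue 𝒪[K] nc₁) = -1 := by
      rw [h1]; exact fun h => by
        have h' : ((1 : ℤ) : ℤ) = -1 := h
        omega
    rw [if_pos h1, mul_one] at hP
    rw [if_neg hm1, mul_zero, mul_zero] at hM
    exact ⟨by rw [hP, sq], hM⟩
  · have hn1 : ¬ quadraticChar 𝓀[K] (IsLocalRing.residue 𝒪[K] LO * IsLocalRing.residue 𝒪[K] nc₁) = 1 := fun h1 => hnQ ⟨hnotPin, hbig.2 h1⟩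
    have hm1 : quadraticChar 𝓀[K] (IsLocalRing.residue 𝒪[K] LO * IsLocalRing.residue 𝒪[K] nc₁) = -1 :=
      (quadraticChar_eq_neg_one_iff_not_one hne).2 hn1
    rw [if_neg hn1, mul_zero, mul_zero] at hP
    rw [if_pos hm1, mul_one] at hM
    exact ⟨hP, by rw [hM, sq]⟩

end Literature.NumberTheory.Rogawski1990.TypeOneRamifiedJunction

end
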